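import Mathlib.MeasureTheory.Group.Integral
import Literature.Analysis.FluidPDE.StationaryEulerTwoStateWaveMeasure
import HarnessLib

/-!
# Realizing laminates of finite order by compactly supported subsolutions
(Choffrut–Székelyhidi 2014, Prop. 6 and Prop. 7)

Topic `Literature/Analysis/FluidPDE`. Support file of the proof of
`Literature.Analysis.FluidPDE.Torus.ChoffrutSzekelyhidi2014_thm1` (Choffrut–Székelyhidi, SIAM
J. Math. Anal. 46 (2014) = arXiv:1401.4301). Prop. 6 of the paper: for an open set `𝒰` and a
laminate of finite order `ν = Σ μᵢ δ_{wᵢ} ∈ 𝓛(𝒰)` with barycentre `w̄`, for every `ε > 0`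
there is a compactly supported smooth subsolution `W` on the cube with `w̄ + W(x) ∈ 𝒰` for all
`x` and `W = wᵢ - w̄` on open sets of measure `≈ μᵢ` ("a simple induction argument and
Lemma 4"). We prove it by structural induction on the splitting tree, in the quantitative form
consumed by the convex-integration step (Prop. 7): the output is a wave packet `P` supported in
the reference cube `B_T` of the frame of the top splitting direction of `T`, with
(i) `w̄ + P.field x ∈ 𝒰` for all `x`, and (ii) `∫ ‖P.field‖² ≥ Var(ν) - ε`, where
`Var(ν) = ∫ ‖w - w̄‖² dν` (so, by Cor. 16, `≥ r' - |v̄|² - ε` for laminates supported in `𝒦_{r'}`).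

Induction step (`split t η q l r`): take the two-state wave of Lemma 4 between `z_l - w̄` and
`z_r - w̄` on `B_T` (values near the segment `[z_l, z_r] ⊆ 𝒰`, exact values on `A_l`, `A_r`);
fill `A_l` (`A_r`) by grid cubes of the frame of `l` (`r`) and add rescaled copies of the packets
realizing `l` and `r` (induction hypothesis); openness margins come from the relative openness
of `𝒰` and compactness of ranges (`IsRelOpen.exists_margin`), the energy identity from
`∫ field = 0` and the parallel-axis theorem.

## References

* A. Choffrut, L. Székelyhidi Jr., SIAM J. Math. Anal. 46 (2014), Lemma 4, Prop. 6, Prop. 7,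
  Cor. 16.
-/

noncomputable section

open scoped InnerProductSpace ContDiff ENNReal
open Set Function MeasureTheory Metric
open Literature.Analysis.FunctionSpaces

namespace Literature.Analysis.FluidPDE

namespace StationaryEuler

variable {d : Type*} [Fintype d] [DecidableEq d]

/-! ## Uniform margins of relatively open sets -/

omit [DecidableEq d] in
/-- **Uniform margin**: a compact subset of a relatively open set has a uniform distance `δ > 0`
within which all admissible states stay in the set (Lebesgue number). [folklore] -/
theorem IsRelOpen.exists_margin {U K : Set (State d)} (hU : IsRelOpen U) (hK : IsCompact K) (hKU : K ⊆ U) :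
    ∃ δ > 0, ∀ p ∈ K, ∀ w', IsAdm w' → dist w' p < δ → w' ∈ U := by
  choose ε hε hεU using fun p : K => hU p.1 (hKU p.2)
  obtain ⟨δ, hδ, hball⟩ := lebesgue_number_lemma_of_metric hK (c := fun p : K => ball (p : State d) (ε p))
    (fun p => isOpen_ball) (fun p hp => mem_iUnion.2 ⟨⟨p, hp⟩, mem_ball_self (hε _)⟩)
  refine ⟨δ, hδ, fun p hp w' hw' hd => ?_⟩
  obtain ⟨p', hp'⟩ := hball p hp
  exact hεU p' w' hw' (mem_ball.1 (hp' (mem_ball.2 hd)))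

/-! ## The certificate of a valid split -/

namespace Laminate

/-- The (normalized) top splitting direction of a tree (`e_{i₀}` for an atom). [folklore] -/
def topEta (i₀ : d) : Laminate d → Ed d
  | atom _ => eb i₀
  | split _ η _ _ _ => ‖η‖⁻¹ • η

/-- The Householder frame of the top splitting direction. [folklore] -/
def frame (i₀ : d) (T : Laminate d) : Ed d ≃ₗᵢ[ℝ] Ed d := houseR i₀ (T.topEta i₀)

omit [DecidableEq d] in
/-- A valid split has a unit normalized direction. [folklore] -/
theorem norm_topEta_split [DecidableEq d] (i₀ : d) {t : ℝ} {η : Ed d} {q : ℝ} {l r : Laminate d} (hη : η ≠ 0) :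
    ‖(split t η q l r).topEta i₀‖ = 1 := by
  rw [topEta, norm_smul, norm_inv, norm_norm, inv_mul_cancel₀ (norm_ne_zero_iff.2 hη)]

end Laminate

/-- **The wave certificate of a valid split** `split t η q l r` with admissible barycentres:
`v̄ = vel (z_r - z_l)`, `S̄ = str (z_r - z_l) + q Id`, unit direction `η/|η|`.
[cite: ChoffrutSzekelyhidi2014, (3.1), Def. 5] -/
def certOfSplit {U : Set (State d)} {t : ℝ} {η : Ed d} {q : ℝ} {l r : Laminate d}
    (h : (Laminate.split t η q l r).IsValid U) (hadm : IsAdm (r.bary - l.bary)) : WaveCert d where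
  vbar := vel (r.bary - l.bary)
  S := str (r.bary - l.bary) + q • (1 : Matrix d d ℝ)
  η := ‖η‖⁻¹ • η
  η_ne := by
    have hη := h.2.2.1
    exact smul_ne_zero (inv_ne_zero (norm_ne_zero_iff.2 hη)) hη
  inner_vbar_η := by rw [inner_smul_right, h.2.2.2.1, mul_zero]
  S_isSymm := hadm.1.add (Matrix.isSymm_one.smul q)
  S_mulVec_η := by
    have hu := h.2.2.2.2.1
    rw [WithLp.ofLp_smul, Matrix.mulVec_smul, hu, smul_zero]

/-- The direction state of the split certificate is `z_r - z_l`. [folklore] -/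
theorem dir_certOfSplit [Nonempty d] {U : Set (State d)} {t : ℝ} {η : Ed d} {q : ℝ} {l r : Laminate d}
    (h : (Laminate.split t η q l r).IsValid U) (hadm : IsAdm (r.bary - l.bary)) :
    (certOfSplit h hadm).dir = r.bary - l.bary := by
  have hc : (Fintype.card d : ℝ) ≠ 0 := by exact_mod_cast Fintype.card_ne_zero
  rw [WaveCert.dir]
  refine ext_vel_str (by rw [vel_mkSt]; rfl) ?_
  rw [str_mkSt]
  change str (r.bary - l.bary) + q • (1 : Matrix d d ℝ) -
    (((str (r.bary - l.bary) + q • (1 : Matrix d d ℝ)).trace / Fintype.card d) : ℝ) • 1 = str (r.bary - l.bary)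
  rw [Matrix.trace_add, hadm.2, Matrix.trace_smul, Matrix.trace_one, zero_add, smul_eq_mul,
    mul_div_cancel_right₀ _ hc, add_sub_cancel_right]

/-- The unit direction of the split certificate. [folklore] -/
theorem norm_η_certOfSplit {U : Set (State d)} {t : ℝ} {η : Ed d} {q : ℝ} {l r : Laminate d}
    (h : (Laminate.split t η q l r).IsValid U) (hadm : IsAdm (r.bary - l.bary)) :
    ‖(certOfSplit h hadm).η‖ = 1 := by
  show ‖‖η‖⁻¹ • η‖ = 1
  rw [norm_smul, norm_inv, norm_norm, inv_mul_cancel₀ (norm_ne_zero_iff.2 h.2.2.1)]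

omit [Fintype d] [DecidableEq d] in
/-- Points `w̄ + θ (z_r - z_l)`, `θ ∈ [-(1-t), t]`, lie on the segment `[z_l, z_r]`. [folklore] -/
theorem bary_add_smul_mem_segment (t : ℝ) (η : Ed d) (q : ℝ) (l r : Laminate d) {θ : ℝ}
    (hθ : θ ∈ Icc (-(1 - t)) t) :
    (Laminate.split t η q l r).bary + θ • (r.bary - l.bary) ∈ segment ℝ l.bary r.bary := by
  refine ⟨t - θ, 1 - t + θ, by linarith [hθ.2], by linarith [hθ.1], by ring, ?_⟩
  rw [Laminate.bary_split]
  module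

/-! ## Compactness of closed aligned cubes -/

omit [DecidableEq d] in
/-- Closed aligned cubes are compact. [folklore] -/
theorem isCompact_acubeClosed (F : Ed d ≃ₗᵢ[ℝ] Ed d) (m : ℕ) (κ : d → ℤ) : IsCompact (acubeClosed F m κ) := by
  have he : ∀ (y : Ed d) (i : d), (PiLp.homeomorph 2 (fun _ : d => ℝ)) y i = y i := fun _ _ => rfl
  have hbox : IsCompact {y : Ed d | ∀ i, y i ∈ Icc ((κ i : ℝ) / m) ((κ i + 1 : ℝ) / m)} := by
    have : {y : Ed d | ∀ i, y i ∈ Icc ((κ i : ℝ) / m) ((κ i + 1 : ℝ) / m)} =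
        (PiLp.homeomorph 2 (fun _ : d => ℝ)) ⁻¹' Set.pi univ fun i => Icc ((κ i : ℝ) / m) ((κ i + 1 : ℝ) / m) := by
      ext y; simp only [mem_setOf_eq, mem_preimage, mem_univ_pi, he]
    rw [this]
    exact (Homeomorph.isCompact_preimage _).2 (isCompact_univ_pi fun i => isCompact_Icc)
  exact (F.toHomeomorph.isCompact_preimage).2 hbox

/-! ## Placing rescaled copies of a packet on grid cubes -/

section Placed

variable (F : Ed d ≃ₗᵢ[ℝ] Ed d) {m : ℕ}

/-- The inverse mesh is non-zero. [folklore] -/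
theorem inv_mesh_ne_zero (hm : 0 < m) : ((m : ℝ)⁻¹) ≠ 0 :=
  inv_ne_zero (by exact_mod_cast hm.ne')

/-- The packet obtained by placing rescaled copies of `Q` on the grid cubes indexed by `S`.
[cite: ChoffrutSzekelyhidi2014, Prop. 6] -/
def placed (hm : 0 < m) (S : Finset (d → ℤ)) (Q : (d → ℤ) → Packet d) : Packet d :=
  S.toList.flatMap fun κ => Packet.rescale (corner F m κ) ((m : ℝ)⁻¹) (inv_mesh_ne_zero hm) (Q κ)

omit [DecidableEq d] in
/-- Field of a `flatMap` of packets. [folklore] -/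
theorem field_flatMap [DecidableEq d] {ι : Type*} (L : List ι) (f : ι → Packet d) (x : Ed d) :
    Packet.field (L.flatMap f) x = (L.map fun i => Packet.field (f i) x).sum := by
  induction L with
  | nil => rfl
  | cons i L ih => rw [List.flatMap_cons, Packet.field_append, ih, List.map_cons, List.sum_cons]

omit [DecidableEq d] in
/-- `SuppIn` of a `flatMap` of packets. [folklore] -/
theorem suppIn_flatMap {ι : Type*} {B : Set (Ed d)} (L : List ι) (f : ι → Packet d)
    (h : ∀ i ∈ L, Packet.SuppIn B (f i)) : Packet.SuppIn B (L.flatMap f) := by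
  induction L with
  | nil => intro τ hτ; simp at hτ
  | cons i L ih =>
    rw [List.flatMap_cons]
    exact Packet.suppIn_append.2 ⟨h i List.mem_cons_self, ih fun j hj => h j (List.mem_cons_of_mem _ hj)⟩

/-- **Field of the placed packet**: `Σ_{κ ∈ S} Q.field (m (x - corner κ))`. [folklore] -/
theorem field_placed (hm : 0 < m) (S : Finset (d → ℤ)) (Q : (d → ℤ) → Packet d) (x : Ed d) :
    Packet.field (placed F hm S Q) x = ∑ κ ∈ S, Packet.field (Q κ) ((m : ℝ) • (x - corner F m κ)) := by
  rw [placed, field_flatMap]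
  simp only [Packet.field_rescale, inv_inv, Finset.sum_map_toList]

omit [DecidableEq d] in
/-- Each rescaled copy is supported in its cube. [folklore] -/
theorem suppIn_rescale_acube (hm : 0 < m) {Q : Packet d} (hQ : Packet.SuppIn (refCube F) Q) (κ : d → ℤ) :
    Packet.SuppIn (acube F m κ) (Packet.rescale (corner F m κ) ((m : ℝ)⁻¹) (inv_mesh_ne_zero hm) Q) := by
  rw [acube_eq_image hm]
  exact Packet.suppIn_rescale hQ _ _

omit [DecidableEq d] in
/-- The placed packet is supported in the union of its cubes. [folklore] -/
theorem suppIn_placed (hm : 0 < m) (S : Finset (d → ℤ)) {Q : (d → ℤ) → Packet d}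
    (hQ : ∀ κ ∈ S, Packet.SuppIn (refCube F) (Q κ)) :
    Packet.SuppIn (⋃ κ ∈ S, acube F m κ) (placed F hm S Q) := by
  refine suppIn_flatMap _ _ fun κ hκ => (suppIn_rescale_acube F hm (hQ κ (Finset.mem_toList.1 hκ)) κ).mono ?_
  exact subset_iUnion₂ (s := fun κ _ => acube F m κ) κ (Finset.mem_toList.1 hκ)

/-- A rescaled copy vanishes off its cube. [folklore] -/
theorem field_rescale_eq_zero (hm : 0 < m) {Q : Packet d} (hQ : Packet.SuppIn (refCube F) Q) {κ : d → ℤ}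
    {x : Ed d} (hx : x ∉ acube F m κ) : Packet.field Q ((m : ℝ) • (x - corner F m κ)) = 0 := by
  have h := Packet.field_eq_zero_of_suppIn (suppIn_rescale_acube F hm hQ κ) hx
  rwa [Packet.field_rescale, inv_inv] at h

/-- **On the cube `κ₀` the placed field is the single copy `κ₀`.** [folklore] -/
theorem field_placed_of_mem (hm : 0 < m) (S : Finset (d → ℤ)) {Q : (d → ℤ) → Packet d}
    (hQ : ∀ κ ∈ S, Packet.SuppIn (refCube F) (Q κ)) {κ₀ : d → ℤ} (hκ₀ : κ₀ ∈ S) {x : Ed d} (hx : x ∈ acube F m κ₀) :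
    Packet.field (placed F hm S Q) x = Packet.field (Q κ₀) ((m : ℝ) • (x - corner F m κ₀)) := by
  rw [field_placed, Finset.sum_eq_single_of_mem κ₀ hκ₀]
  intro κ hκS hκ
  exact field_rescale_eq_zero F hm (hQ κ hκS) fun h => (disjoint_acube hm hκ).ne_of_mem h hx rfl

/-- Off the cubes the placed field vanishes. [folklore] -/
theorem field_placed_of_not_mem (hm : 0 < m) (S : Finset (d → ℤ)) {Q : (d → ℤ) → Packet d}
    (hQ : ∀ κ ∈ S, Packet.SuppIn (refCube F) (Q κ)) {x : Ed d} (hx : ∀ κ ∈ S, x ∉ acube F m κ) :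
    Packet.field (placed F hm S Q) x = 0 := by
  rw [field_placed]
  exact Finset.sum_eq_zero fun κ hκ => field_rescale_eq_zero F hm (hQ κ hκ) (hx κ hκ)

omit [DecidableEq d] in
/-- **Integral of a rescaled copy**: `∫ Q.field (m (x - c)) dx = 0`. [folklore] -/
theorem integral_field_rescaled [DecidableEq d] (Q : Packet d) (m : ℕ) (c : Ed d) :
    ∫ x, Packet.field Q ((m : ℝ) • (x - c)) = 0 := by
  rw [show (fun x => Packet.field Q ((m : ℝ) • (x - c))) = fun x => (fun y => Packet.field Q ((m : ℝ) • y)) (x - c)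
    from rfl, integral_sub_right_eq_self (μ := volume) (fun y => Packet.field Q ((m : ℝ) • y)) c,
    Measure.integral_comp_smul volume (Packet.field Q) (m : ℝ), Packet.integral_field, smul_zero]

omit [DecidableEq d] in
/-- **Energy of a rescaled copy**: `∫ ‖Q.field (m (x - c))‖² dx = m^{-d} ∫ ‖Q.field‖²`. [folklore] -/
theorem integral_sq_field_rescaled [DecidableEq d] (hm : 0 < m) (Q : Packet d) (c : Ed d) :
    ∫ x, ‖Packet.field Q ((m : ℝ) • (x - c))‖ ^ 2 = ((m : ℝ)⁻¹) ^ Fintype.card d * ∫ x, ‖Packet.field Q x‖ ^ 2 := by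
  have hm' : (0 : ℝ) < m := by exact_mod_cast hm
  rw [show (fun x => ‖Packet.field Q ((m : ℝ) • (x - c))‖ ^ 2) =
      fun x => (fun y => ‖Packet.field Q ((m : ℝ) • y)‖ ^ 2) (x - c) from rfl,
    integral_sub_right_eq_self (μ := volume) (fun y => ‖Packet.field Q ((m : ℝ) • y)‖ ^ 2) c,
    Measure.integral_comp_smul volume (fun y => ‖Packet.field Q y‖ ^ 2) (m : ℝ), finrank_euclideanSpace,
    smul_eq_mul, abs_of_pos (by positivity), inv_pow]

omit [DecidableEq d] in
/-- The energy density of a packet is integrable. [folklore] -/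
theorem integrable_sq_field [DecidableEq d] (Q : Packet d) : Integrable fun x => ‖Packet.field Q x‖ ^ 2 := by
  have h : HasCompactSupport (fun x => ‖Packet.field Q x‖ ^ 2) :=
    (Packet.hasCompactSupport_field Q).mono fun x hx h0 => hx (by simp [h0])
  exact ((Packet.continuous_field Q).norm.pow 2).integrable_of_hasCompactSupport h

/-- **Energy of the placed copies on one cube** against a constant `a`:
`∫_{acube κ} ‖a + Q.field(m(x - cκ))‖² = m^{-d} (‖a‖² + ∫ ‖Q.field‖²)`. [folklore] -/
theorem setIntegral_sq_const_add (hm : 0 < m) {Q : Packet d} (hQ : Packet.SuppIn (refCube F) Q) (κ : d → ℤ)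
    (a : State d) :
    ∫ x in acube F m κ, ‖a + Packet.field Q ((m : ℝ) • (x - corner F m κ))‖ ^ 2 =
      ((m : ℝ)⁻¹) ^ Fintype.card d * (‖a‖ ^ 2 + ∫ x, ‖Packet.field Q x‖ ^ 2) := by
  set G : Ed d → State d := fun x => Packet.field Q ((m : ℝ) • (x - corner F m κ)) with hG
  have hGc : Continuous G := (Packet.continuous_field Q).comp (by fun_prop)
  have hG0 : ∀ x ∉ acube F m κ, G x = 0 := fun x hx => field_rescale_eq_zero F hm hQ hx
  have hGsupp : support G ⊆ acube F m κ := fun x hx => by_contra fun h => hx (hG0 x h)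
  have hGcs : HasCompactSupport G :=
    IsCompact.of_isClosed_subset (isCompact_acubeClosed F m κ) (isClosed_tsupport G)
      (closure_minimal (hGsupp.trans (acube_subset_acubeClosed m κ)) (isCompact_acubeClosed F m κ).isClosed)
  have hGi : Integrable G := hGc.integrable_of_hasCompactSupport hGcs
  have hGi2 : Integrable fun x => ‖G x‖ ^ 2 :=
    (hGc.norm.pow 2).integrable_of_hasCompactSupport (hGcs.mono fun x hx h0 => hx (by simp [h0]))
  have hGin : Integrable fun x => 2 * ⟪a, G x⟫_ℝ := ((hGi.const_inner a).const_mul 2)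
  -- expand the square
  have hexp : (fun x => ‖a + G x‖ ^ 2) = fun x => ‖a‖ ^ 2 + (2 * ⟪a, G x⟫_ℝ + ‖G x‖ ^ 2) := by
    funext x; rw [norm_add_sq_real]; ring
  have hvol : volume.real (acube F m κ) = ((m : ℝ)⁻¹) ^ Fintype.card d := volume_real_acube hm κ
  have hfin : volume (acube F m κ) ≠ ⊤ := by rw [volume_acube hm]; exact ENNReal.pow_ne_top ENNReal.ofReal_ne_top
  have hc1 : IntegrableOn (fun _ : Ed d => ‖a‖ ^ 2) (acube F m κ) volume := integrableOn_const hfin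
  have hc2 : IntegrableOn (fun x => 2 * ⟪a, G x⟫_ℝ + ‖G x‖ ^ 2) (acube F m κ) volume := (hGin.add hGi2).integrableOn
  rw [hexp, integral_add hc1 hc2, setIntegral_const, hvol, integral_add hGin.integrableOn hGi2.integrableOn]
  -- the two non-constant terms are whole-space integrals
  have hI1 : ∫ x in acube F m κ, 2 * ⟪a, G x⟫_ℝ = ∫ x, 2 * ⟪a, G x⟫_ℝ :=
    setIntegral_eq_integral_of_forall_compl_eq_zero fun x hx => by rw [hG0 x hx, inner_zero_right, mul_zero]
  have hI2 : ∫ x in acube F m κ, ‖G x‖ ^ 2 = ∫ x, ‖G x‖ ^ 2 :=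
    setIntegral_eq_integral_of_forall_compl_eq_zero fun x hx => by rw [hG0 x hx, norm_zero]; norm_num
  rw [hI1, hI2, integral_const_mul, integral_inner hGi a, hG, integral_field_rescaled Q m,
    inner_zero_right, mul_zero, zero_add, integral_sq_field_rescaled hm Q, smul_eq_mul]
  ring

end Placed

/-! ## Proposition 6 -/

/-- **Prop. 6 (realization of laminates of finite order), quantitative form.** Let `𝒰` be a
relatively open set of admissible states and `ν` a laminate of finite order in `𝓛(𝒰)` (a valid
splitting tree `T`) with barycentre `w̄`. For every `ε > 0` there is a wave packet `P` — a smooth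
compactly supported subsolution — with potentials supported in the reference cube of the frame
of `T` such that `w̄ + P.field x ∈ 𝒰` for all `x` and `∫ ‖P.field‖² ≥ Var(ν) - ε`.
[cite: ChoffrutSzekelyhidi2014, Prop. 6] -/
theorem realize [Nonempty d] (i₀ : d) {U : Set (State d)} (hUo : IsRelOpen U) (hUA : U ⊆ Adm)
    (T : Laminate d) (hT : T.IsValid U) {ε : ℝ} (hε : 0 < ε) :
    ∃ P : Packet d, P.SuppIn (refCube (T.frame i₀)) ∧ (∀ x, T.bary + P.field x ∈ U) ∧
      T.var T.bary - ε ≤ ∫ x, ‖P.field x‖ ^ 2 := by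
  induction T generalizing ε with
  | atom w =>
    refine ⟨[], fun τ hτ => by simp at hτ, fun x => ?_, ?_⟩
    · rw [Packet.field_nil, add_zero]; exact hT
    · simp only [Laminate.var_atom, Laminate.bary_atom, sub_self, norm_zero, ne_eq, OfNat.ofNat_ne_zero,
        not_false_eq_true, zero_pow, zero_sub, Packet.field_nil, integral_zero]
      linarith
  | split t η q l r ihl ihr =>
    -- data of the split
    obtain ⟨ht0, ht1, hη, hvη, huη, hseg, hl, hr⟩ := hT
    have hT : (Laminate.split t η q l r).IsValid U := ⟨ht0, ht1, hη, hvη, huη, hseg, hl, hr⟩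
    set zl := l.bary with hzl
    set zr := r.bary with hzr
    set wb := (Laminate.split t η q l r).bary with hwb
    have hzlU : zl ∈ U := hl.bary_mem
    have hzrU : zr ∈ U := hr.bary_mem
    have hadm_l : IsAdm zl := hUA hzlU
    have hadm_r : IsAdm zr := hUA hzrU
    have hadm : IsAdm (zr - zl) := hadm_r.sub hadm_l
    have hwbU : wb ∈ U := hT.bary_mem
    have hadm_w : IsAdm wb := hUA hwbU
    set c := certOfSplit hT hadm with hc
    have hcdir : c.dir = zr - zl := dir_certOfSplit hT hadm
    have hcη : ‖c.η‖ = 1 := norm_η_certOfSplit hT hadm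
    have hframe : houseR i₀ c.η = (Laminate.split t η q l r).frame i₀ := rfl
    -- Step 1: the children (tolerance ε/4)
    have hε4 : 0 < ε / 4 := by linarith
    obtain ⟨Pl, hPl_supp, hPl_U, hPl_gain⟩ := ihl hl hε4
    obtain ⟨Pr, hPr_supp, hPr_U, hPr_gain⟩ := ihr hr hε4
    set Il := ∫ x, ‖Packet.field Pl x‖ ^ 2 with hIl
    set Ir := ∫ x, ‖Packet.field Pr x‖ ^ 2 with hIr
    have hIl0 : 0 ≤ Il := integral_nonneg fun x => by positivity
    have hIr0 : 0 ≤ Ir := integral_nonneg fun x => by positivity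
    set Xl := l.var wb with hXl
    set Xr := r.var wb with hXr
    have hXl0 : 0 ≤ Xl := Laminate.var_nonneg hl.weightsIn _
    have hXr0 : 0 ≤ Xr := Laminate.var_nonneg hr.weightsIn _
    have hXl_eq : Xl = l.var zl + ‖zl - wb‖ ^ 2 := Laminate.var_eq_var_bary_add l wb
    have hXr_eq : Xr = r.var zr + ‖zr - wb‖ ^ 2 := Laminate.var_eq_var_bary_add r wb
    have hvarT : (Laminate.split t η q l r).var wb = t * Xl + (1 - t) * Xr := Laminate.var_split wb t η q l r
    -- Step 2: margins
    obtain ⟨δl, hδl, hmarg_l⟩ := hUo.exists_margin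
      (((Packet.hasCompactSupport_field Pl).isCompact_range (Packet.continuous_field Pl)).image
        (continuous_const.add continuous_id)) (by rintro _ ⟨_, ⟨x, rfl⟩, rfl⟩; exact hPl_U x)
    obtain ⟨δr, hδr, hmarg_r⟩ := hUo.exists_margin
      (((Packet.hasCompactSupport_field Pr).isCompact_range (Packet.continuous_field Pr)).image
        (continuous_const.add continuous_id)) (by rintro _ ⟨_, ⟨x, rfl⟩, rfl⟩; exact hPr_U x)
    have hsegc : IsCompact (segment ℝ zl zr) := by
      rw [segment_eq_image]
      exact isCompact_Icc.image (by fun_prop)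
    obtain ⟨δs, hδs, hmarg_s⟩ := hUo.exists_margin hsegc hseg
    -- Step 3: the two-state wave with waste `e` and value tolerance `δs/2`
    set e : ℝ := ε / (8 * (Xl + Xr + 1)) with he
    have he0 : 0 < e := by positivity
    have heX : e * (Xl + Xr) ≤ ε / 8 := by
      rw [he, div_mul_eq_mul_div, div_le_div_iff₀ (by positivity) (by norm_num)]
      nlinarith
    obtain ⟨φ₀, hφ₀s, hφ₀c, hφ₀supp, hvals, Al, Ar, hAlo, hAro, hAlB, hArB, hdisj, hWl, hWr, hvolAl, hvolAr⟩ :=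
      exists_twoState c hcη i₀ ht0 ht1 he0 (half_pos hδs)
    set τ₀ : WaveTerm d := ⟨c, φ₀, hφ₀s, hφ₀c⟩ with hτ₀
    -- Step 4: fill `Al` and `Ar` by cubes of the children's frames
    have hfinAl : volume Al ≠ ⊤ :=
      ne_top_of_le_ne_top (by rw [volume_refCube]; exact ENNReal.one_ne_top) (measure_mono hAlB)
    have hfinAr : volume Ar ≠ ⊤ :=
      ne_top_of_le_ne_top (by rw [volume_refCube]; exact ENNReal.one_ne_top) (measure_mono hArB)
    obtain ⟨ml, hml0, Sl, hSl_sub, hSl_vol⟩ := exists_acubes_subset (R := l.frame i₀) hAlo hfinAl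
      (ENNReal.ofReal_pos.2 he0).ne' 0
    obtain ⟨mr, hmr0, Sr, hSr_sub, hSr_vol⟩ := exists_acubes_subset (R := r.frame i₀) hAro hfinAr
      (ENNReal.ofReal_pos.2 he0).ne' 0
    have hml : 0 < ml := hml0
    have hmr : 0 < mr := hmr0
    have hcubel : ∀ κ ∈ Sl, acube (l.frame i₀) ml κ ⊆ Al := fun κ hκ =>
      (acube_subset_acubeClosed ml κ).trans (hSl_sub κ hκ)
    have hcuber : ∀ κ ∈ Sr, acube (r.frame i₀) mr κ ⊆ Ar := fun κ hκ =>
      (acube_subset_acubeClosed mr κ).trans (hSr_sub κ hκ)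
    -- Step 5: the packet
    set P : Packet d := [τ₀] ++ placed (l.frame i₀) hml Sl (fun _ => Pl) ++ placed (r.frame i₀) hmr Sr (fun _ => Pr) with hP
    have hfield : ∀ x, Packet.field P x = c.field φ₀ x + Packet.field (placed (l.frame i₀) hml Sl (fun _ => Pl)) x +
        Packet.field (placed (r.frame i₀) hmr Sr (fun _ => Pr)) x := fun x => by
      rw [hP, Packet.field_append, Packet.field_append, Packet.field_cons, Packet.field_nil, add_zero]; rfl
    have hcaseA : ∀ κ ∈ Sl, ∀ x ∈ acube (l.frame i₀) ml κ,
        Packet.field P x = (zl - wb) + Packet.field Pl ((ml : ℝ) • (x - corner (l.frame i₀) ml κ)) := by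
      intro κ hκ x hx
      have hxAl : x ∈ Al := hcubel κ hκ hx
      have h1 : c.field φ₀ x = zl - wb := by
        rw [hWl x hxAl, hcdir, hwb, Laminate.bary_split]; module
      have h2 : Packet.field (placed (l.frame i₀) hml Sl (fun _ => Pl)) x =
          Packet.field Pl ((ml : ℝ) • (x - corner (l.frame i₀) ml κ)) :=
        field_placed_of_mem _ hml Sl (fun _ _ => hPl_supp) hκ hx
      have h3 : Packet.field (placed (r.frame i₀) hmr Sr (fun _ => Pr)) x = 0 :=
        field_placed_of_not_mem _ hmr Sr (fun _ _ => hPr_supp) fun κ' hκ' hx' =>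
          hdisj.ne_of_mem hxAl (hcuber κ' hκ' hx') rfl
      rw [hfield, h1, h2, h3, add_zero]
    have hcaseB : ∀ κ ∈ Sr, ∀ x ∈ acube (r.frame i₀) mr κ,
        Packet.field P x = (zr - wb) + Packet.field Pr ((mr : ℝ) • (x - corner (r.frame i₀) mr κ)) := by
      intro κ hκ x hx
      have hxAr : x ∈ Ar := hcuber κ hκ hx
      have h1 : c.field φ₀ x = zr - wb := by
        rw [hWr x hxAr, hcdir, hwb, Laminate.bary_split]; module
      have h2 : Packet.field (placed (l.frame i₀) hml Sl (fun _ => Pl)) x = 0 :=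
        field_placed_of_not_mem _ hml Sl (fun _ _ => hPl_supp) fun κ' hκ' hx' =>
          hdisj.ne_of_mem (hcubel κ' hκ' hx') hxAr rfl
      have h3 : Packet.field (placed (r.frame i₀) hmr Sr (fun _ => Pr)) x =
          Packet.field Pr ((mr : ℝ) • (x - corner (r.frame i₀) mr κ)) :=
        field_placed_of_mem _ hmr Sr (fun _ _ => hPr_supp) hκ hx
      rw [hfield, h1, h2, h3, add_zero]
    refine ⟨P, ?_, fun x => ?_, ?_⟩
    · -- supports
      rw [hP, Packet.suppIn_append, Packet.suppIn_append]
      refine ⟨⟨fun τ hτ => ?_, (suppIn_placed _ hml Sl (fun _ _ => hPl_supp)).mono (iUnion₂_subset fun κ hκ =>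
        (hcubel κ hκ).trans hAlB)⟩, (suppIn_placed _ hmr Sr (fun _ _ => hPr_supp)).mono (iUnion₂_subset fun κ hκ =>
        (hcuber κ hκ).trans hArB)⟩
      rw [List.mem_singleton] at hτ
      subst hτ
      exact hφ₀supp
    · -- values in `U`
      have hadmP : IsAdm (wb + Packet.field P x) := hadm_w.add (Packet.isAdm_field P x)
      by_cases hxl : ∃ κ ∈ Sl, x ∈ acube (l.frame i₀) ml κ
      · obtain ⟨κ, hκ, hx⟩ := hxl
        rw [hcaseA κ hκ x hx, ← add_assoc, add_sub_cancel]
        exact hPl_U _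
      by_cases hxr : ∃ κ ∈ Sr, x ∈ acube (r.frame i₀) mr κ
      · obtain ⟨κ, hκ, hx⟩ := hxr
        rw [hcaseB κ hκ x hx, ← add_assoc, add_sub_cancel]
        exact hPr_U _
      · push Not at hxl hxr
        have h2 : Packet.field (placed (l.frame i₀) hml Sl (fun _ => Pl)) x = 0 :=
          field_placed_of_not_mem _ hml Sl (fun _ _ => hPl_supp) hxl
        have h3 : Packet.field (placed (r.frame i₀) hmr Sr (fun _ => Pr)) x = 0 :=
          field_placed_of_not_mem _ hmr Sr (fun _ _ => hPr_supp) hxr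
        rw [hfield, h2, h3, add_zero, add_zero] at hadmP ⊢
        obtain ⟨θ, hθ, hclose⟩ := hvals x
        have hp : wb + θ • (zr - zl) ∈ segment ℝ zl zr := bary_add_smul_mem_segment t η q l r hθ
        refine hmarg_s _ hp _ hadmP ?_
        rw [dist_eq_norm, add_sub_add_left_eq_sub, ← hcdir]
        exact hclose.trans_lt (half_lt_self hδs)
    · -- the gain
      have hintP : Integrable fun x => ‖Packet.field P x‖ ^ 2 := integrable_sq_field P
      have hmeas_l : ∀ κ ∈ Sl, MeasurableSet (acube (l.frame i₀) ml κ) := fun κ _ => measurableSet_acube ml κ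
      have hmeas_r : ∀ κ ∈ Sr, MeasurableSet (acube (r.frame i₀) mr κ) := fun κ _ => measurableSet_acube mr κ
      set UL := ⋃ κ ∈ Sl, acube (l.frame i₀) ml κ with hUL
      set UR := ⋃ κ ∈ Sr, acube (r.frame i₀) mr κ with hUR
      have hULAl : UL ⊆ Al := iUnion₂_subset hcubel
      have hURAr : UR ⊆ Ar := iUnion₂_subset hcuber
      have hdisjLR : Disjoint UL UR := hdisj.mono hULAl hURAr
      have hmUL : MeasurableSet UL := MeasurableSet.biUnion Sl.countable_toSet hmeas_l
      have hmUR : MeasurableSet UR := MeasurableSet.biUnion Sr.countable_toSet hmeas_r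
      have hB1 : volume (refCube (houseR i₀ c.η)) = 1 := volume_refCube _
      have hfinB : volume (refCube (houseR i₀ c.η)) ≠ ⊤ := by
        rw [hB1]; exact ENNReal.one_ne_top
      -- energies on the cubes
      have hEl : ∫ x in UL, ‖Packet.field P x‖ ^ 2 =
          Sl.card * (((ml : ℝ)⁻¹) ^ Fintype.card d * (‖zl - wb‖ ^ 2 + Il)) := by
        rw [hUL, integral_biUnion_finset Sl hmeas_l (fun κ _ κ' _ h => disjoint_acube hml h)
          fun κ _ => hintP.integrableOn]
        rw [Finset.sum_congr rfl fun κ hκ => ?_, Finset.sum_const, nsmul_eq_mul]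
        rw [setIntegral_congr_fun (measurableSet_acube ml κ) fun x hx => by rw [hcaseA κ hκ x hx]]
        exact setIntegral_sq_const_add _ hml hPl_supp κ (zl - wb)
      have hEr : ∫ x in UR, ‖Packet.field P x‖ ^ 2 =
          Sr.card * (((mr : ℝ)⁻¹) ^ Fintype.card d * (‖zr - wb‖ ^ 2 + Ir)) := by
        rw [hUR, integral_biUnion_finset Sr hmeas_r (fun κ _ κ' _ h => disjoint_acube hmr h)
          fun κ _ => hintP.integrableOn]
        rw [Finset.sum_congr rfl fun κ hκ => ?_, Finset.sum_const, nsmul_eq_mul]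
        rw [setIntegral_congr_fun (measurableSet_acube mr κ) fun x hx => by rw [hcaseB κ hκ x hx]]
        exact setIntegral_sq_const_add _ hmr hPr_supp κ (zr - wb)
      -- volumes of the cube families
      have hvL : volume.real UL = Sl.card * ((ml : ℝ)⁻¹) ^ Fintype.card d := by
        rw [Measure.real, hUL, volume_biUnion_acube hml, ENNReal.toReal_mul, ENNReal.toReal_natCast,
          ENNReal.toReal_pow, ENNReal.toReal_ofReal (by positivity)]
      have hvR : volume.real UR = Sr.card * ((mr : ℝ)⁻¹) ^ Fintype.card d := by
        rw [Measure.real, hUR, volume_biUnion_acube hmr, ENNReal.toReal_mul, ENNReal.toReal_natCast,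
          ENNReal.toReal_pow, ENNReal.toReal_ofReal (by positivity)]
      have hB1r : volume.real (refCube (houseR i₀ c.η)) = 1 := by
        rw [Measure.real, hB1, ENNReal.toReal_one]
      have hvL1 : volume.real UL ≤ 1 := (measureReal_mono (μ := volume) (hULAl.trans hAlB) hfinB).trans_eq hB1r
      have hvR1 : volume.real UR ≤ 1 := (measureReal_mono (μ := volume) (hURAr.trans hArB) hfinB).trans_eq hB1r
      have hvLge : t - e - e ≤ volume.real UL := by
        have h1 : volume.real Al ≤ volume.real UL + volume.real (Al \ UL) := by
          calc volume.real Al ≤ volume.real (UL ∪ (Al \ UL)) :=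
                measureReal_mono (μ := volume) (fun x hx => by
                  by_cases h : x ∈ UL
                  · exact Or.inl h
                  · exact Or.inr ⟨hx, h⟩) (ne_top_of_le_ne_top hfinAl (measure_mono
                    (union_subset hULAl sdiff_subset)))
            _ ≤ volume.real UL + volume.real (Al \ UL) := measureReal_union_le _ _
        have h2 : volume.real (Al \ UL) ≤ e := ENNReal.toReal_le_of_le_ofReal he0.le hSl_vol.le
        linarith
      have hvRge : (1 - t) - e - e ≤ volume.real UR := by
        have h1 : volume.real Ar ≤ volume.real UR + volume.real (Ar \ UR) := by
          calc volume.real Ar ≤ volume.real (UR ∪ (Ar \ UR)) :=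
                measureReal_mono (μ := volume) (fun x hx => by
                  by_cases h : x ∈ UR
                  · exact Or.inl h
                  · exact Or.inr ⟨hx, h⟩) (ne_top_of_le_ne_top hfinAr (measure_mono
                    (union_subset hURAr sdiff_subset)))
            _ ≤ volume.real UR + volume.real (Ar \ UR) := measureReal_union_le _ _
        have h2 : volume.real (Ar \ UR) ≤ e := ENNReal.toReal_le_of_le_ofReal he0.le hSr_vol.le
        linarith
      -- the total energy dominates the energy on the cubes
      have hsplit : ∫ x in UL ∪ UR, ‖Packet.field P x‖ ^ 2 =
          (∫ x in UL, ‖Packet.field P x‖ ^ 2) + ∫ x in UR, ‖Packet.field P x‖ ^ 2 :=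
        setIntegral_union hdisjLR hmUR hintP.integrableOn hintP.integrableOn
      have hle : ∫ x in UL ∪ UR, ‖Packet.field P x‖ ^ 2 ≤ ∫ x, ‖Packet.field P x‖ ^ 2 :=
        setIntegral_le_integral hintP (Filter.Eventually.of_forall fun x => by positivity)
      -- arithmetic
      have hvL0 : 0 ≤ volume.real UL := measureReal_nonneg
      have hvR0 : 0 ≤ volume.real UR := measureReal_nonneg
      have hYl : Xl - ε / 4 ≤ ‖zl - wb‖ ^ 2 + Il := by rw [hXl_eq]; linarith
      have hYr : Xr - ε / 4 ≤ ‖zr - wb‖ ^ 2 + Ir := by rw [hXr_eq]; linarith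
      have hEl' : volume.real UL * (Xl - ε / 4) ≤ ∫ x in UL, ‖Packet.field P x‖ ^ 2 := by
        rw [hEl, ← mul_assoc, ← hvL]; exact mul_le_mul_of_nonneg_left hYl hvL0
      have hEr' : volume.real UR * (Xr - ε / 4) ≤ ∫ x in UR, ‖Packet.field P x‖ ^ 2 := by
        rw [hEr, ← mul_assoc, ← hvR]; exact mul_le_mul_of_nonneg_left hYr hvR0
      have hkeyl : (t - 2 * e) * Xl - ε / 4 ≤ volume.real UL * (Xl - ε / 4) := by
        have a1 : (t - 2 * e) * Xl ≤ volume.real UL * Xl := mul_le_mul_of_nonneg_right (by linarith) hXl0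
        have a2 : volume.real UL * (ε / 4) ≤ ε / 4 := mul_le_of_le_one_left (by linarith) hvL1
        have a3 : volume.real UL * (Xl - ε / 4) = volume.real UL * Xl - volume.real UL * (ε / 4) := by ring
        linarith
      have hkeyr : ((1 - t) - 2 * e) * Xr - ε / 4 ≤ volume.real UR * (Xr - ε / 4) := by
        have a1 : ((1 - t) - 2 * e) * Xr ≤ volume.real UR * Xr := mul_le_mul_of_nonneg_right (by linarith) hXr0
        have a2 : volume.real UR * (ε / 4) ≤ ε / 4 := mul_le_of_le_one_left (by linarith) hvR1
        have a3 : volume.real UR * (Xr - ε / 4) = volume.real UR * Xr - volume.real UR * (ε / 4) := by ring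
        linarith
      have r1 : (t - 2 * e) * Xl = t * Xl - 2 * (e * Xl) := by ring
      have r2 : ((1 - t) - 2 * e) * Xr = (1 - t) * Xr - 2 * (e * Xr) := by ring
      have r3 : e * (Xl + Xr) = e * Xl + e * Xr := by ring
      rw [hvarT]
      linarith

end StationaryEuler

end Literature.Analysis.FluidPDE
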